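import Literature.Probability.RandomPlanarGeometry.SLEBoundaryHitting
import HarnessLib

/-!
# Lawler's re-targeting Möbius map `Φ_x(z) = x z/(z + x)` of the upper half-plane

Topic `Probability/RandomPlanarGeometry`. G. F. Lawler, *Conformally Invariant Processes in the
Plane* (2005), §6.3, before Prop. 6.14: "Suppose `γ*(t)` is SLE₆ in `ℍ` connecting `0` and
`x > 0`. We can construct this by `Φ ∘ γ(t)` where `Φ(z) = zx/(z+x)` is a Möbius transformation of
`ℍ` with `Φ(0) = 0`, `Φ(∞) = x`." This file provides the map and the deterministic bookkeeping
needed to transport chordal SLE between the two targets `∞` and `x` of `(ℍ; 0, x, ∞)` and, through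
a chordal uniformizing map `ψ : ℍ → D` with `ψ(x) = p₁`, between the Dobrushin domains
`(D; p₀, p₂)` and `(D; p₀, p₁)` of a three-marked Jordan domain (the "by conformal invariance"
step of Lawler's Prop. 6.14 / Lawler–Schramm–Werner (2001) Cor. 2.3, splitting form of locality):

* `retargetMoebius x z = x z/(z + x)` (pole `-x`, junk `0` there), with `im Φ_x = x² im/|z+x|²`
  (`im_apply`), so `Φ_x : ℍ → ℍ` (`mapsTo`), its inverse `Φ_{-x}` (`neg_apply_apply`),
  holomorphy and continuity off the pole, and `Φ_x(z) → x` at `∞` (`tendsto_cocompact`);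
* `retargetMoebius.mem_realRay_iff` — **`Φ_x` exchanges the closed rays**: for `z ≠ -x` in the
  closed half-plane, `Φ_x z ∈ realRay x ↔ z ∈ realRay (-x)` (the arc `[x, ∞]` of `∂ℍ` not
  containing `0` pulls back to the closed ray from the pole);
* `retargetMoebiusEquiv x hx : ConformalEquiv ℍ ℍ` and the re-targeted chordal map:
  `retargetMoebius.isChordalUniformizing_trans` — if `ψ` uniformizes `D.chord 0 2` and has
  boundary value `p₁` at `x`, then `ψ ∘ Φ_x` uniformizes `D.chord 0 1`;
  `retargetMoebius.boundaryExtension_trans` — off the pole, the boundary extension of `ψ ∘ Φ_x`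
  is `ψ.boundaryExtension ∘ Φ_x`.

## References

* G. F. Lawler, *Conformally Invariant Processes in the Plane*, AMS (2005), §6.3 (Thm. 6.13,
  Prop. 6.14). [Lawler2005]
* G. F. Lawler, O. Schramm, W. Werner, Acta Math. 187 (2001), Cor. 2.3. [LawlerSchrammWerner2001]
-/

noncomputable section

open Set Filter Topology Complex
open UpperHalfPlane (upperHalfPlaneSet)
open scoped NNReal

namespace Literature.Probability.RandomPlanarGeometry

/-! ### Lawler's re-targeting Möbius map `Φ_x(z) = x z / (z + x)` -/

/-- **Lawler's re-targeting Möbius map** `Φ_x(z) = x z/(z + x)` of the upper half-plane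
(Lawler (2005), §6.3, before Prop. 6.14: "`Φ(z) = zx/(z+x)` is a Möbius transformation of `ℍ`
with `Φ(0) = 0`, `Φ(∞) = x`"): it fixes `0`, sends `∞` to `x` and has its pole at `-x`
(junk value `0` at the pole, by `w / 0 = 0`). The image of chordal SLE₆ (from `0` to `∞`) under
`Φ_x` is chordal SLE₆ in `ℍ` from `0` to `x`. [cite: Lawler2005, §6.3] -/
def retargetMoebius (x : ℝ) (z : ℂ) : ℂ :=
  x * z / (z + x)

namespace retargetMoebius

variable {x : ℝ}

/-- Pointwise formula. [folklore] -/
theorem apply (x : ℝ) (z : ℂ) : retargetMoebius x z = x * z / (z + x) := rfl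

/-- `Φ_x(0) = 0`. [folklore] -/
@[simp] theorem map_zero (x : ℝ) : retargetMoebius x 0 = 0 := by simp [retargetMoebius]

/-- Off the pole the denominator does not vanish. [folklore] -/
theorem denom_ne_zero {z : ℂ} (hz : z ≠ -x) : z + x ≠ 0 := by
  intro h
  exact hz (eq_neg_of_add_eq_zero_left h)

/-- Points of the closed upper half-plane other than `-x` are off the pole. [folklore] -/
theorem ne_neg_of_im_pos {z : ℂ} (hz : 0 < z.im) : z ≠ -x := by
  rintro rfl
  simp at hz

/-- **The imaginary part of `Φ_x`**: `im Φ_x(z) = x² im z/|z + x|²`. [folklore] -/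
theorem im_apply {z : ℂ} (hz : z ≠ -x) :
    (retargetMoebius x z).im = x ^ 2 * z.im / Complex.normSq (z + x) := by
  have hd : z + x ≠ 0 := denom_ne_zero hz
  rw [apply, Complex.div_im]
  simp only [mul_re, ofReal_re, ofReal_im, zero_mul, sub_zero, add_re, mul_im, add_im,
    add_zero]
  field_simp
  ring

/-- `Φ_x` maps the open upper half-plane into itself (`x ≠ 0`). [folklore] -/
theorem im_pos (hx : x ≠ 0) {z : ℂ} (hz : 0 < z.im) : 0 < (retargetMoebius x z).im := by
  rw [im_apply (ne_neg_of_im_pos hz)]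
  have h1 : 0 < Complex.normSq (z + x) := Complex.normSq_pos.2 (denom_ne_zero (ne_neg_of_im_pos hz))
  positivity

/-- `Φ_x` maps `ℍ` to `ℍ`. [folklore] -/
theorem mapsTo (hx : x ≠ 0) : MapsTo (retargetMoebius x) upperHalfPlaneSet upperHalfPlaneSet :=
  fun _ hz ↦ im_pos hx hz

/-- Real points other than the pole are mapped to real points. [folklore] -/
theorem im_eq_zero {z : ℂ} (hz : z ≠ -x) (hreal : z.im = 0) : (retargetMoebius x z).im = 0 := by
  rw [im_apply hz, hreal, mul_zero, zero_div]

/-- The closed upper half-plane minus the pole is mapped into the closed upper half-plane.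
[folklore] -/
theorem im_nonneg {z : ℂ} (hz : z ≠ -x) (h : 0 ≤ z.im) : 0 ≤ (retargetMoebius x z).im := by
  rw [im_apply hz]
  exact div_nonneg (mul_nonneg (sq_nonneg _) h) (Complex.normSq_nonneg _)

/-- `Φ_x` is continuous off the pole. [folklore] -/
theorem continuousAt {z : ℂ} (hz : z ≠ -x) : ContinuousAt (retargetMoebius x) z := by
  unfold retargetMoebius
  exact (continuousAt_const.mul continuousAt_id).div (continuousAt_id.add continuousAt_const)
    (denom_ne_zero hz)

/-- `Φ_x` is continuous on the complement of the pole. [folklore] -/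
theorem continuousOn : ContinuousOn (retargetMoebius x) {z | z ≠ -x} := fun _ hz ↦
  (continuousAt hz).continuousWithinAt

/-- `Φ_x` is holomorphic off the pole. [folklore] -/
theorem differentiableOn : DifferentiableOn ℂ (retargetMoebius x) {z | z ≠ -x} := by
  intro z hz
  unfold retargetMoebius
  exact ((differentiableAt_const _).mul differentiableAt_id).differentiableWithinAt.div
    (differentiableAt_id.add (differentiableAt_const _)).differentiableWithinAt (denom_ne_zero hz)

/-- **The inverse**: `Φ_x⁻¹(w) = x w/(x - w)` inverts `Φ_x` off the pole (`x ≠ 0`). [folklore] -/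
theorem inv_apply (hx : x ≠ 0) {z : ℂ} (hz : z ≠ -x) :
    x * retargetMoebius x z / (x - retargetMoebius x z) = z := by
  have hd : z + x ≠ 0 := denom_ne_zero hz
  have hx' : (x : ℂ) ≠ 0 := ofReal_ne_zero.2 hx
  rw [apply]
  have h2 : (x : ℂ) - x * z / (z + x) = x * x / (z + x) := by
    field_simp
    ring
  rw [h2]
  field_simp

/-- `Φ_x` composed with `w ↦ x w/(x - w)` is the identity off `w = x` (`x ≠ 0`). [folklore] -/
theorem apply_inv (hx : x ≠ 0) {w : ℂ} (hw : w ≠ x) :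
    retargetMoebius x (x * w / (x - w)) = w := by
  have hd : (x : ℂ) - w ≠ 0 := sub_ne_zero.2 (Ne.symm hw)
  have hx' : (x : ℂ) ≠ 0 := ofReal_ne_zero.2 hx
  rw [apply]
  have h2 : (x : ℂ) * w / (x - w) + x = x * x / (x - w) := by
    field_simp
    ring
  rw [h2]
  field_simp

/-- **`Φ_{-x}` inverts `Φ_x`** off the pole (`x ≠ 0`): `Φ_{-x}(Φ_x(z)) = z`. [folklore] -/
theorem neg_apply_apply (hx : x ≠ 0) {z : ℂ} (hz : z ≠ -x) :
    retargetMoebius (-x) (retargetMoebius x z) = z := by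
  have hd : z + x ≠ 0 := denom_ne_zero hz
  have hx' : (x : ℂ) ≠ 0 := ofReal_ne_zero.2 hx
  have h2 : (x : ℂ) * z / (z + x) + ((-x : ℝ) : ℂ) = -(x * x) / (z + x) := by
    push_cast
    field_simp
    ring
  rw [apply (-x), apply x, h2]
  have h3 : -((x : ℂ) * x) / (z + x) ≠ 0 := div_ne_zero (neg_ne_zero.2 (mul_ne_zero hx' hx')) hd
  push_cast
  field_simp

/-- `Φ_x` never takes the value `x` off the pole (`x ≠ 0`). [folklore] -/
theorem apply_ne (hx : x ≠ 0) {z : ℂ} (hz : z ≠ -x) : retargetMoebius x z ≠ x := by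
  intro h
  have := inv_apply hx hz
  rw [h, sub_self, div_zero] at this
  rw [← this, map_zero] at h
  exact hx (by exact_mod_cast h.symm)

/-- **`Φ_x` exchanges the two closed rays**: for a point `z ≠ -x` of the closed upper half-plane,
`Φ_x(z)` lies on the closed real ray from `x` away from `0` iff `z` lies on the closed real ray
from `-x` away from `0` (`x > 0`: `Φ_x(t) ≥ x ⟺ t < -x`; `x < 0`: `Φ_x(t) ≤ x ⟺ t > -x`).
[folklore] -/
theorem mem_realRay_iff (hx : x ≠ 0) {z : ℂ} (hz : z ≠ -x) (h : 0 ≤ z.im) :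
    retargetMoebius x z ∈ realRay x ↔ z ∈ realRay (-x) := by
  rcases h.lt_or_eq with hpos | hzero
  · -- points of `ℍ` are on neither ray
    have h1 : retargetMoebius x z ∉ realRay x := fun hm ↦ (im_pos hx hpos).ne' hm.1
    have h2 : z ∉ realRay (-x) := fun hm ↦ hpos.ne' hm.1
    exact ⟨fun hm ↦ absurd hm h1, fun hm ↦ absurd hm h2⟩
  · -- real points `t ≠ -x`
    have hzr : z = ((z.re : ℝ) : ℂ) := Complex.ext (by simp) (by simp [hzero])
    set t : ℝ := z.re with ht
    have htx : t + x ≠ 0 := by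
      intro h0
      apply hz
      rw [hzr]
      exact_mod_cast (eq_neg_of_add_eq_zero_left h0)
    have hval : retargetMoebius x z = ((x * t / (t + x) : ℝ) : ℂ) := by
      rw [hzr, apply]
      push_cast
      ring
    have key : ∀ s : ℝ, ((s : ℝ) : ℂ) ∈ realRay x ↔ (0 < x → x ≤ s) ∧ (x < 0 → s ≤ x) := fun s ↦ by
      simp [realRay]
    rw [hval, key, hzr]
    simp only [realRay, mem_setOf_eq, ofReal_im, ofReal_re, true_and, Left.neg_pos_iff,
      Left.neg_neg_iff]
    -- sign analysis
    have hiff : x * t / (t + x) - x = -(x * x) / (t + x) := by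
      field_simp
      ring
    rcases lt_or_gt_of_ne hx with hxneg | hxpos
    · constructor
      · rintro ⟨-, hle⟩
        have hle' := hle hxneg
        refine ⟨fun _ ↦ ?_, fun h ↦ absurd hxneg (by linarith)⟩
        -- `x t/(t+x) ≤ x`, `x < 0` ⟹ `t + x > 0`
        by_contra hcon
        push Not at hcon
        have htx' : t + x < 0 := lt_of_le_of_ne (by linarith) htx
        have : 0 ≤ x * t / (t + x) - x := by
          rw [hiff]
          exact div_nonneg_of_nonpos (by nlinarith) htx'.le
        have h3 : x * t / (t + x) - x = 0 := le_antisymm (by linarith) this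
        rw [hiff, div_eq_zero_iff] at h3
        rcases h3 with h3 | h3
        · have : x * x = 0 := by linarith
          exact hx (mul_self_eq_zero.1 this)
        · exact htx h3
      · rintro ⟨hge, -⟩
        have hge' : -x ≤ t := hge (by linarith)
        have htx' : 0 < t + x := lt_of_le_of_ne (by linarith) (Ne.symm htx)
        refine ⟨fun h ↦ absurd hxneg (by linarith), fun _ ↦ ?_⟩
        have : x * t / (t + x) - x ≤ 0 := by
          rw [hiff]
          exact div_nonpos_of_nonpos_of_nonneg (by nlinarith) htx'.le
        linarith
    · constructor
      · rintro ⟨hle, -⟩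
        have hle' := hle hxpos
        refine ⟨fun h ↦ absurd hxpos (by linarith), fun _ ↦ ?_⟩
        by_contra hcon
        push Not at hcon
        have htx' : 0 < t + x := lt_of_le_of_ne (by linarith) (Ne.symm htx)
        have : x * t / (t + x) - x ≤ 0 := by
          rw [hiff]
          exact div_nonpos_of_nonpos_of_nonneg (by nlinarith) htx'.le
        have h3 : x * t / (t + x) - x = 0 := le_antisymm this (by linarith)
        rw [hiff, div_eq_zero_iff] at h3
        rcases h3 with h3 | h3
        · have : x * x = 0 := by linarith
          exact hx (mul_self_eq_zero.1 this)
        · exact htx h3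
      · rintro ⟨-, hle⟩
        have hle' : t ≤ -x := hle (by linarith)
        have htx' : t + x < 0 := lt_of_le_of_ne (by linarith) htx
        refine ⟨fun _ ↦ ?_, fun h ↦ absurd hxpos (by linarith)⟩
        have : 0 ≤ x * t / (t + x) - x := by
          rw [hiff]
          exact div_nonneg_of_nonpos (by nlinarith) htx'.le
        linarith

/-- **`Φ_x(z) → x` as `z → ∞`.** [folklore] -/
theorem tendsto_cocompact (x : ℝ) : Tendsto (retargetMoebius x) (cocompact ℂ) (𝓝 x) := by
  -- `Φ_x(z) - x = -x²/(z + x)` and `1/(z + x) → 0`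
  have h1 : Tendsto (fun z : ℂ ↦ z + x) (Bornology.cobounded ℂ) (Bornology.cobounded ℂ) :=
    tendsto_add_const_cobounded (x : ℂ)
  have h2 : Tendsto (fun z : ℂ ↦ (z + x)⁻¹) (cocompact ℂ) (𝓝 0) := by
    rw [← Metric.cobounded_eq_cocompact]
    exact Filter.tendsto_inv₀_cobounded.comp h1
  have h3 : Tendsto (fun z : ℂ ↦ (x : ℂ) + -(x * x) * (z + x)⁻¹) (cocompact ℂ) (𝓝 (x + -(x * x) * 0)) :=
    tendsto_const_nhds.add (tendsto_const_nhds.mul h2)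
  rw [mul_zero, add_zero] at h3
  refine h3.congr' ?_
  have hev : ∀ᶠ z : ℂ in cocompact ℂ, z ≠ -x := by
    rw [← Metric.cobounded_eq_cocompact]
    exact Bornology.eventually_ne_cobounded _
  filter_upwards [hev] with z hz
  have hd := denom_ne_zero hz
  rw [apply]
  field_simp
  ring

end retargetMoebius

/-! ### `Φ_x` as a conformal automorphism of `ℍ`; the re-targeted uniformizing map -/

/-- **`Φ_x` as a conformal automorphism of the upper half-plane** (`x ≠ 0`), with inverse
`Φ_{-x}(w) = x w/(x - w)`. [cite: Lawler2005, §6.3] -/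
def retargetMoebiusEquiv (x : ℝ) (hx : x ≠ 0) :
    ConformalEquiv upperHalfPlaneSet upperHalfPlaneSet where
  toPartialEquiv :=
    { toFun := retargetMoebius x
      invFun := retargetMoebius (-x)
      source := upperHalfPlaneSet
      target := upperHalfPlaneSet
      map_source' := fun _ hz ↦ retargetMoebius.mapsTo hx hz
      map_target' := fun _ hw ↦ retargetMoebius.mapsTo (neg_ne_zero.2 hx) hw
      left_inv' := fun z hz ↦
        retargetMoebius.neg_apply_apply hx (retargetMoebius.ne_neg_of_im_pos hz)
      right_inv' := fun w hw ↦ by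
        have h := retargetMoebius.neg_apply_apply (neg_ne_zero.2 hx)
          (retargetMoebius.ne_neg_of_im_pos hw)
        rwa [neg_neg] at h }
  source_eq := rfl
  target_eq := rfl
  differentiableOn := retargetMoebius.differentiableOn.mono fun _ hz ↦
    retargetMoebius.ne_neg_of_im_pos hz
  differentiableOn_symm := retargetMoebius.differentiableOn.mono fun _ hz ↦
    retargetMoebius.ne_neg_of_im_pos hz

/-- `retargetMoebiusEquiv x` acts as `Φ_x`. [folklore] -/
@[simp] theorem retargetMoebiusEquiv_apply (x : ℝ) (hx : x ≠ 0) (z : ℂ) :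
    retargetMoebiusEquiv x hx z = retargetMoebius x z := rfl

namespace retargetMoebius

variable {x : ℝ} {V : Set ℂ}

/-- `Φ_x` tends to `Φ_x(z)` within `ℍ` at every point `z ≠ -x`. [folklore] -/
theorem tendsto_nhdsWithin (hx : x ≠ 0) {z : ℂ} (hz : z ≠ -x) :
    Tendsto (retargetMoebius x) (𝓝[upperHalfPlaneSet] z)
      (𝓝[upperHalfPlaneSet] (retargetMoebius x z)) :=
  (continuousAt hz).continuousWithinAt.tendsto_nhdsWithin (mapsTo hx)

/-- `Φ_x` tends to `x` within `ℍ` at infinity. [folklore] -/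
theorem tendsto_cocompact_inf (hx : x ≠ 0) :
    Tendsto (retargetMoebius x) (cocompact ℂ ⊓ 𝓟 upperHalfPlaneSet)
      (𝓝[upperHalfPlaneSet] (x : ℂ)) := by
  rw [tendsto_nhdsWithin_iff]
  refine ⟨(tendsto_cocompact x).mono_left inf_le_left, ?_⟩
  exact eventually_inf_principal.2 (Eventually.of_forall fun z hz ↦ mapsTo hx hz)

/-- **Boundary values of the re-targeted map**: if `ψ : ℍ → V` has boundary value `p` at the
real point `Φ_x(z)` (`z ≠ -x`), then `Φ_x` followed by `ψ` has boundary value `p` at `z`. [folklore] -/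
theorem hasBoundaryValue_trans (hx : x ≠ 0) (ψ : ConformalEquiv upperHalfPlaneSet V) {z p : ℂ}
    (hz : z ≠ -x) (hψ : ψ.HasBoundaryValue (retargetMoebius x z) p) :
    ((retargetMoebiusEquiv x hx).trans ψ).HasBoundaryValue z p :=
  hψ.comp (tendsto_nhdsWithin hx hz)

/-- **Boundary value at infinity of the re-targeted map**: if `ψ` has boundary value `b` at the
real point `x`, then `Φ_x` followed by `ψ` has boundary value `b` at `∞`. [folklore] -/
theorem hasBoundaryValueAtInfty_trans (hx : x ≠ 0) (ψ : ConformalEquiv upperHalfPlaneSet V)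
    {b : ℂ} (hψ : ψ.HasBoundaryValue x b) :
    ((retargetMoebiusEquiv x hx).trans ψ).HasBoundaryValueAtInfty b :=
  hψ.comp (tendsto_cocompact_inf hx)

/-- **The re-targeted chordal uniformizing map.** If `ψ : ℍ → D` is a chordal uniformizing map
of `(D; p₀, p₂) = D.chord 0 2` (`0 ↦ p₀`, `∞ ↦ p₂`) with boundary value `p₁` at the real point
`x ≠ 0`, then `ψ ∘ Φ_x` is a chordal uniformizing map of `(D; p₀, p₁) = D.chord 0 1`
(`0 ↦ p₀`, `∞ ↦ x ↦ p₁`). Lawler (2005), §6.3 (proof of Prop. 6.14, "by conformal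
invariance"). [cite: Lawler2005, §6.3] -/
theorem isChordalUniformizing_trans (hx : x ≠ 0) {D : MarkedDomain 3}
    {ψ : ConformalEquiv upperHalfPlaneSet D.carrier}
    (hψ : (D.chord 0 2 (by decide)).IsChordalUniformizing ψ) (h₁ : ψ.HasBoundaryValue x (D.pt 1)) :
    (D.chord 0 1 (by decide)).IsChordalUniformizing ((retargetMoebiusEquiv x hx).trans ψ) := by
  refine ⟨?_, ?_⟩
  · have h0 : ψ.HasBoundaryValue (retargetMoebius x 0) (D.pt 0) := by
      rw [map_zero]
      exact hψ.1
    have h00 : (0 : ℂ) ≠ -x := by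
      rw [ne_eq, zero_eq_neg]
      exact_mod_cast hx
    exact hasBoundaryValue_trans hx ψ h00 h0
  · exact hasBoundaryValueAtInfty_trans hx ψ h₁

/-- **The boundary extension of the re-targeted map** off the pole: if the boundary extension of
`ψ : ℍ → V` is continuous on the closed half-plane, then for `z` in the closed half-plane with
`z ≠ -x`, the boundary extension of `ψ ∘ Φ_x` at `z` is `ψ.boundaryExtension (Φ_x z)`. [folklore] -/
theorem boundaryExtension_trans (hx : x ≠ 0) (ψ : ConformalEquiv upperHalfPlaneSet V)
    (hcont : ContinuousOn ψ.boundaryExtension (closure upperHalfPlaneSet)) {z : ℂ}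
    (hz0 : 0 ≤ z.im) (hz : z ≠ -x) :
    ((retargetMoebiusEquiv x hx).trans ψ).boundaryExtension z =
      ψ.boundaryExtension (retargetMoebius x z) := by
  have hcl : closure upperHalfPlaneSet = {w : ℂ | 0 ≤ w.im} := Complex.closure_setOf_lt_im 0
  have hzcl : z ∈ closure upperHalfPlaneSet := by rw [hcl]; exact hz0
  have hwcl : retargetMoebius x z ∈ closure upperHalfPlaneSet := by
    rw [hcl]; exact im_nonneg hz hz0
  refine ConformalEquiv.boundaryExtension_eq_of_hasBoundaryValue _ hzcl ?_
  refine hasBoundaryValue_trans hx ψ hz ?_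
  -- `ψ w' → ψ.boundaryExtension w` as `w' → w` within `ℍ`
  have h1 : Tendsto ψ.boundaryExtension (𝓝[upperHalfPlaneSet] retargetMoebius x z)
      (𝓝 (ψ.boundaryExtension (retargetMoebius x z))) :=
    ((hcont _ hwcl).mono subset_closure).tendsto
  exact h1.congr' (eventually_nhdsWithin_of_forall fun w hw ↦ ψ.boundaryExtension_eq hw)

end retargetMoebius

end Literature.Probability.RandomPlanarGeometry

end
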